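import Mathlib
import Summits.Parity.GeneralizedHardyLittlewood.Theses.LiouvilleMAD
import Summits.Parity.GeneralizedHardyLittlewood.Theorems.LiouvilleMADCosetDecorrelationStubFluctModeIffMeanCorrected

/-!
# Honesty glue of line `Sketch`: its two modes are the crux plus its mean-mode debt

Stub `stub_modesIff` of line `Sketch` (card `gram-split-farey-phase`, ideator 2) of crux
stmt-Parity-13317 (`Summit.Parity.GeneralizedHardyLittlewood.Theses.LiouvilleMAD.CosetDecorrelation`),
registered glue stub of the re-audit lead c3 (2026-08-17).

The line splits the coset sum `T_j(n,n') = Σ_{(m,m')∈(M,2M]², m≡m' (j)} λ(mn+c)λ(m'n'+c)` into its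
rank-one MEAN MODE `S(n)S(n')/j` (`S(n) = Σ_{m∈(M,2M]} λ(mn+c)`) and the FLUCTUATION MODE
`Σ_{a<j} (A_n(a) − S(n)/j)(A_{n'}(a) − S(n')/j)` (`A_n(a) = Σ_{m % j = a} λ(mn+c)`), and files the
two hypothesis families M (`|S(n)S(n')/j| ≤ C·M^{3/4+ϑ}`) and F (`|fluctuation| ≤ C·M^{3/4+ϑ}`),
`ϑ < 1/4`, on the crux's ranges.  This file kernel-checks the exact logical position of that stub
set:

* `cosetDecorrelation_of_modes` : M → F → `CosetDecorrelation` (the line's composition: the Gram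
  identity `fluct_eq_meanCorrected` (p108842) + triangle inequality, `ϑ := max ϑ₁ ϑ₂`);
* `fluctMode_of_cosetDecorrelation_of_meanMode` : `CosetDecorrelation` → M → F (same identity read
  backwards: `|T − SS'/j| ≤ |T| + |SS'/j|`);
* `stub_modesIff` : **(M ∧ F) ↔ (CosetDecorrelation ∧ M)**.

So line `Sketch` is EQUIVALENT to the crux conjoined with its mean-mode family M, and M alone already
implies the quasi-Riemann hypothesis at some abscissa `θ < 3/4` (`stub_quasiRH_of_meanMode`, p108799):
the line is the crux made strictly harder by a quasi-RH(3/4)-grade one-point debt — the costume test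
of TRIAGE-r1 for this line, as one kernel-checked equivalence (companion of `stub_splitIff`, p108330,
which does the same for line `SketchIdeator3`'s pair K1/K2).  No definitions are declared. [folklore]
-/

namespace Summit.Parity.GeneralizedHardyLittlewood.Theorems.CosetDecorrelation.GramSplitFareyPhase

open Finset
open Summit.Parity.GeneralizedHardyLittlewood.Theses.LiouvilleMAD (CosetDecorrelation)

/-- Exponent/constant bookkeeping shared by both directions: two bounds `|X| ≤ C₁ M^{3/4+ϑ₁}`,
`|Y| ≤ C₂ M^{3/4+ϑ₂}` with `M ≥ 1` give `|X| + |Y| ≤ (max C₁ 0 + max C₂ 0) · M^{3/4 + max ϑ₁ ϑ₂}`.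
[folklore] -/
theorem modes_add_le {X Y C₁ C₂ ϑ₁ ϑ₂ : ℝ} {M : ℕ} (hM : 1 ≤ M)
    (h1 : |X| ≤ C₁ * (M : ℝ) ^ (3 / 4 + ϑ₁)) (h2 : |Y| ≤ C₂ * (M : ℝ) ^ (3 / 4 + ϑ₂)) :
    |X| + |Y| ≤ (max C₁ 0 + max C₂ 0) * (M : ℝ) ^ (3 / 4 + max ϑ₁ ϑ₂) := by
  have hMr : (1 : ℝ) ≤ M := by exact_mod_cast hM
  have hMpos : (0 : ℝ) < M := by linarith
  have m1 : (M : ℝ) ^ (3 / 4 + ϑ₁) ≤ (M : ℝ) ^ (3 / 4 + max ϑ₁ ϑ₂) :=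
    Real.rpow_le_rpow_of_exponent_le hMr (by linarith [le_max_left ϑ₁ ϑ₂])
  have m2 : (M : ℝ) ^ (3 / 4 + ϑ₂) ≤ (M : ℝ) ^ (3 / 4 + max ϑ₁ ϑ₂) :=
    Real.rpow_le_rpow_of_exponent_le hMr (by linarith [le_max_right ϑ₁ ϑ₂])
  have p1 : 0 ≤ (M : ℝ) ^ (3 / 4 + ϑ₁) := Real.rpow_nonneg hMpos.le _
  have p2 : 0 ≤ (M : ℝ) ^ (3 / 4 + ϑ₂) := Real.rpow_nonneg hMpos.le _
  have e1 := (h1.trans (mul_le_mul_of_nonneg_right (le_max_left C₁ 0) p1)).trans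
    (mul_le_mul_of_nonneg_left m1 (le_max_right C₁ 0))
  have e2 := (h2.trans (mul_le_mul_of_nonneg_right (le_max_left C₂ 0) p2)).trans
    (mul_le_mul_of_nonneg_left m2 (le_max_right C₂ 0))
  calc |X| + |Y| ≤ max C₁ 0 * (M : ℝ) ^ (3 / 4 + max ϑ₁ ϑ₂) + max C₂ 0 * (M : ℝ) ^ (3 / 4 + max ϑ₁ ϑ₂) :=
        add_le_add e1 e2
    _ = (max C₁ 0 + max C₂ 0) * (M : ℝ) ^ (3 / 4 + max ϑ₁ ϑ₂) := by ring

/-- **The composition of line `Sketch`**: the mean-mode family M and the fluctuation-mode family F give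
`CosetDecorrelation` (`T = SS'/j + fluctuation`, triangle inequality). [folklore] -/
theorem cosetDecorrelation_of_modes
    (hMean : ∀ c : ℤ, c ≠ 0 → ∃ ϑ : ℝ, ϑ < 1 / 4 ∧ ∃ C : ℝ, ∀ M n n' j : ℕ, 1 ≤ n → 1 ≤ n' → n ≠ n' →
      n ≤ 2 * M → n' ≤ 2 * M → Nat.sqrt M + 1 ≤ j → j < 2 * (Nat.sqrt M + 1) →
        |(∑ m ∈ Finset.Ioc M (2 * M), (ArithmeticFunction.liouville (Int.toNat ((m : ℤ) * n + c)) : ℝ)) *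
            (∑ m ∈ Finset.Ioc M (2 * M), (ArithmeticFunction.liouville (Int.toNat ((m : ℤ) * n' + c)) : ℝ)) /
              (j : ℝ)| ≤ C * (M : ℝ) ^ (3 / 4 + ϑ))
    (hFluct : ∀ c : ℤ, c ≠ 0 → ∃ ϑ : ℝ, ϑ < 1 / 4 ∧ ∃ C : ℝ, ∀ M n n' j : ℕ, 1 ≤ n → 1 ≤ n' → n ≠ n' →
      n ≤ 2 * M → n' ≤ 2 * M → Nat.sqrt M + 1 ≤ j → j < 2 * (Nat.sqrt M + 1) →
        |∑ a ∈ Finset.range j,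
            ((∑ m ∈ (Finset.Ioc M (2 * M)).filter (fun m => m % j = a),
                (ArithmeticFunction.liouville (Int.toNat ((m : ℤ) * n + c)) : ℝ))
              - (∑ m ∈ Finset.Ioc M (2 * M),
                  (ArithmeticFunction.liouville (Int.toNat ((m : ℤ) * n + c)) : ℝ)) / (j : ℝ)) *
            ((∑ m ∈ (Finset.Ioc M (2 * M)).filter (fun m => m % j = a),
                (ArithmeticFunction.liouville (Int.toNat ((m : ℤ) * n' + c)) : ℝ))
              - (∑ m ∈ Finset.Ioc M (2 * M),
                  (ArithmeticFunction.liouville (Int.toNat ((m : ℤ) * n' + c)) : ℝ)) / (j : ℝ))|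
          ≤ C * (M : ℝ) ^ (3 / 4 + ϑ)) :
    CosetDecorrelation := by
  intro c hc
  obtain ⟨ϑ₁, hϑ₁, C₁, h1⟩ := hMean c hc
  obtain ⟨ϑ₂, hϑ₂, C₂, h2⟩ := hFluct c hc
  refine ⟨max ϑ₁ ϑ₂, max_lt hϑ₁ hϑ₂, max C₁ 0 + max C₂ 0, ?_⟩
  intro M n n' j hn hn' hne hnM hn'M hj1 hj2
  have hM : 1 ≤ M := by omega
  have hj : 1 ≤ j := le_trans (Nat.succ_le_succ (Nat.zero_le _)) hj1
  have e1 := h1 M n n' j hn hn' hne hnM hn'M hj1 hj2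
  have e2 := h2 M n n' j hn hn' hne hnM hn'M hj1 hj2
  have e := fluct_eq_meanCorrected
    (fun m => (ArithmeticFunction.liouville (Int.toNat ((m : ℤ) * n + c)) : ℝ))
    (fun m => (ArithmeticFunction.liouville (Int.toNat ((m : ℤ) * n' + c)) : ℝ)) M j hj
  rw [e] at e2
  set T : ℝ := ∑ p ∈ (Finset.Ioc M (2 * M) ×ˢ Finset.Ioc M (2 * M)).filter
      (fun p : ℕ × ℕ => p.1 ≡ p.2 [MOD j]),
    (ArithmeticFunction.liouville (Int.toNat ((p.1 : ℤ) * n + c)) : ℝ) *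
      (ArithmeticFunction.liouville (Int.toNat ((p.2 : ℤ) * n' + c)) : ℝ) with hTdef
  set P : ℝ := (∑ m ∈ Finset.Ioc M (2 * M),
      (ArithmeticFunction.liouville (Int.toNat ((m : ℤ) * n + c)) : ℝ)) *
    (∑ m ∈ Finset.Ioc M (2 * M),
      (ArithmeticFunction.liouville (Int.toNat ((m : ℤ) * n' + c)) : ℝ)) / (j : ℝ) with hPdef
  have hsum := modes_add_le hM e1 e2
  calc |T| = |P + (T - P)| := by ring_nf
    _ ≤ |P| + |T - P| := abs_add_le _ _
    _ ≤ (max C₁ 0 + max C₂ 0) * (M : ℝ) ^ (3 / 4 + max ϑ₁ ϑ₂) := hsum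

/-- **Honesty of line `Sketch`**: conversely the crux and the mean-mode family give the fluctuation
family, by `|T − SS'/j| ≤ |T| + |SS'/j|`. [folklore] -/
theorem fluctMode_of_cosetDecorrelation_of_meanMode (hC : CosetDecorrelation)
    (hMean : ∀ c : ℤ, c ≠ 0 → ∃ ϑ : ℝ, ϑ < 1 / 4 ∧ ∃ C : ℝ, ∀ M n n' j : ℕ, 1 ≤ n → 1 ≤ n' → n ≠ n' →
      n ≤ 2 * M → n' ≤ 2 * M → Nat.sqrt M + 1 ≤ j → j < 2 * (Nat.sqrt M + 1) →
        |(∑ m ∈ Finset.Ioc M (2 * M), (ArithmeticFunction.liouville (Int.toNat ((m : ℤ) * n + c)) : ℝ)) *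
            (∑ m ∈ Finset.Ioc M (2 * M), (ArithmeticFunction.liouville (Int.toNat ((m : ℤ) * n' + c)) : ℝ)) /
              (j : ℝ)| ≤ C * (M : ℝ) ^ (3 / 4 + ϑ)) :
    ∀ c : ℤ, c ≠ 0 → ∃ ϑ : ℝ, ϑ < 1 / 4 ∧ ∃ C : ℝ, ∀ M n n' j : ℕ, 1 ≤ n → 1 ≤ n' → n ≠ n' →
      n ≤ 2 * M → n' ≤ 2 * M → Nat.sqrt M + 1 ≤ j → j < 2 * (Nat.sqrt M + 1) →
        |∑ a ∈ Finset.range j,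
            ((∑ m ∈ (Finset.Ioc M (2 * M)).filter (fun m => m % j = a),
                (ArithmeticFunction.liouville (Int.toNat ((m : ℤ) * n + c)) : ℝ))
              - (∑ m ∈ Finset.Ioc M (2 * M),
                  (ArithmeticFunction.liouville (Int.toNat ((m : ℤ) * n + c)) : ℝ)) / (j : ℝ)) *
            ((∑ m ∈ (Finset.Ioc M (2 * M)).filter (fun m => m % j = a),
                (ArithmeticFunction.liouville (Int.toNat ((m : ℤ) * n' + c)) : ℝ))
              - (∑ m ∈ Finset.Ioc M (2 * M),
                  (ArithmeticFunction.liouville (Int.toNat ((m : ℤ) * n' + c)) : ℝ)) / (j : ℝ))|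
          ≤ C * (M : ℝ) ^ (3 / 4 + ϑ) := by
  intro c hc
  obtain ⟨ϑ₁, hϑ₁, C₁, h1⟩ := hC c hc
  obtain ⟨ϑ₂, hϑ₂, C₂, h2⟩ := hMean c hc
  refine ⟨max ϑ₁ ϑ₂, max_lt hϑ₁ hϑ₂, max C₁ 0 + max C₂ 0, ?_⟩
  intro M n n' j hn hn' hne hnM hn'M hj1 hj2
  have hM : 1 ≤ M := by omega
  have hj : 1 ≤ j := le_trans (Nat.succ_le_succ (Nat.zero_le _)) hj1
  have e1 := h1 M n n' j hn hn' hne hnM hn'M hj1 hj2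
  have e2 := h2 M n n' j hn hn' hne hnM hn'M hj1 hj2
  rw [fluct_eq_meanCorrected
    (fun m => (ArithmeticFunction.liouville (Int.toNat ((m : ℤ) * n + c)) : ℝ))
    (fun m => (ArithmeticFunction.liouville (Int.toNat ((m : ℤ) * n' + c)) : ℝ)) M j hj]
  set T : ℝ := ∑ p ∈ (Finset.Ioc M (2 * M) ×ˢ Finset.Ioc M (2 * M)).filter
      (fun p : ℕ × ℕ => p.1 ≡ p.2 [MOD j]),
    (ArithmeticFunction.liouville (Int.toNat ((p.1 : ℤ) * n + c)) : ℝ) *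
      (ArithmeticFunction.liouville (Int.toNat ((p.2 : ℤ) * n' + c)) : ℝ) with hTdef
  set P : ℝ := (∑ m ∈ Finset.Ioc M (2 * M),
      (ArithmeticFunction.liouville (Int.toNat ((m : ℤ) * n + c)) : ℝ)) *
    (∑ m ∈ Finset.Ioc M (2 * M),
      (ArithmeticFunction.liouville (Int.toNat ((m : ℤ) * n' + c)) : ℝ)) / (j : ℝ) with hPdef
  have hsum := modes_add_le hM e1 e2
  calc |T - P| ≤ |T| + |P| := abs_sub _ _
    _ ≤ (max C₁ 0 + max C₂ 0) * (M : ℝ) ^ (3 / 4 + max ϑ₁ ϑ₂) := hsum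

/-- **STUB `stub_modesIff`** (registered glue stub of line `Sketch`, crux stmt-Parity-13317): the
line's stub pair is the crux plus its mean-mode debt — `(M ∧ F) ↔ (CosetDecorrelation ∧ M)`.  In words:
given the mean-mode family M, the line's residual F (fluctuation mode) is equivalent to the crux
itself; and M already implies quasi-RH at some `θ < 3/4` (`stub_quasiRH_of_meanMode`, p108799).
[folklore] -/
theorem stub_modesIff :
    ((∀ c : ℤ, c ≠ 0 → ∃ ϑ : ℝ, ϑ < 1 / 4 ∧ ∃ C : ℝ, ∀ M n n' j : ℕ, 1 ≤ n → 1 ≤ n' → n ≠ n' →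
      n ≤ 2 * M → n' ≤ 2 * M → Nat.sqrt M + 1 ≤ j → j < 2 * (Nat.sqrt M + 1) →
        |(∑ m ∈ Finset.Ioc M (2 * M), (ArithmeticFunction.liouville (Int.toNat ((m : ℤ) * n + c)) : ℝ)) *
            (∑ m ∈ Finset.Ioc M (2 * M), (ArithmeticFunction.liouville (Int.toNat ((m : ℤ) * n' + c)) : ℝ)) /
              (j : ℝ)| ≤ C * (M : ℝ) ^ (3 / 4 + ϑ)) ∧
     (∀ c : ℤ, c ≠ 0 → ∃ ϑ : ℝ, ϑ < 1 / 4 ∧ ∃ C : ℝ, ∀ M n n' j : ℕ, 1 ≤ n → 1 ≤ n' → n ≠ n' →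
      n ≤ 2 * M → n' ≤ 2 * M → Nat.sqrt M + 1 ≤ j → j < 2 * (Nat.sqrt M + 1) →
        |∑ a ∈ Finset.range j,
            ((∑ m ∈ (Finset.Ioc M (2 * M)).filter (fun m => m % j = a),
                (ArithmeticFunction.liouville (Int.toNat ((m : ℤ) * n + c)) : ℝ))
              - (∑ m ∈ Finset.Ioc M (2 * M),
                  (ArithmeticFunction.liouville (Int.toNat ((m : ℤ) * n + c)) : ℝ)) / (j : ℝ)) *
            ((∑ m ∈ (Finset.Ioc M (2 * M)).filter (fun m => m % j = a),
                (ArithmeticFunction.liouville (Int.toNat ((m : ℤ) * n' + c)) : ℝ))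
              - (∑ m ∈ Finset.Ioc M (2 * M),
                  (ArithmeticFunction.liouville (Int.toNat ((m : ℤ) * n' + c)) : ℝ)) / (j : ℝ))|
          ≤ C * (M : ℝ) ^ (3 / 4 + ϑ))) ↔
    (Summit.Parity.GeneralizedHardyLittlewood.Theses.LiouvilleMAD.CosetDecorrelation ∧
     (∀ c : ℤ, c ≠ 0 → ∃ ϑ : ℝ, ϑ < 1 / 4 ∧ ∃ C : ℝ, ∀ M n n' j : ℕ, 1 ≤ n → 1 ≤ n' → n ≠ n' →
      n ≤ 2 * M → n' ≤ 2 * M → Nat.sqrt M + 1 ≤ j → j < 2 * (Nat.sqrt M + 1) →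
        |(∑ m ∈ Finset.Ioc M (2 * M), (ArithmeticFunction.liouville (Int.toNat ((m : ℤ) * n + c)) : ℝ)) *
            (∑ m ∈ Finset.Ioc M (2 * M), (ArithmeticFunction.liouville (Int.toNat ((m : ℤ) * n' + c)) : ℝ)) /
              (j : ℝ)| ≤ C * (M : ℝ) ^ (3 / 4 + ϑ))) :=
  ⟨fun h => ⟨cosetDecorrelation_of_modes h.1 h.2, h.1⟩,
   fun h => ⟨h.2, fluctMode_of_cosetDecorrelation_of_meanMode h.1 h.2⟩⟩

end Summit.Parity.GeneralizedHardyLittlewood.Theorems.CosetDecorrelation.GramSplitFareyPhase
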